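import Literature.NumberTheory.Automorphic.GL2CCoeffModelEquiv
import Literature.NumberTheory.Automorphic.ArchSmoothFrechetGL
import HarnessLib

/-!
# The coefficient module `E_λ(ℂ)` of `Res GL₂` over an imaginary quadratic field as a
# representation of `GL₂(ℂ)`: rational points, one-parameter subgroups, derivative, centre

For a totally complex field `K` with one infinite place (imaginary quadratic), `GL₂(ℂ)` is the
archimedean group: `embGL : GL₂(ℂ) →* G_∞ = GL₂(K_∞)` (entrywise `ImaginaryQuadratic.ofComplex`,
so that `ofArch ∘ embGL = ImaginaryQuadratic.ofComplexGL`).  Composing with the archimedean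
coefficient representation `archCoeffRep` gives **`coeffRepC K λ : GL₂(ℂ) → GL(E_λ(ℂ))`** with:

* `coeffRepC_ratToComplexGL` — on rational points `γ ∈ GL₂(K) ↪ GL₂(ℂ)` it is the algebraic
  representation `coeffRep ℂ 2 K λ γ` defining the local system (`archCoeffRep_diagArch`);
* `embGL_expGL` — `embGL (exp Y) = exp (φ_{w₀} Y)` (`NormedSpace.map_exp`), hence
  `hasDerivAt_coeffRepC_expGL` — **`d/ds|₀ ℓ(E(M exp sY) v) = ℓ(E(M) dE(φ_{w₀} Y) v)`** with
  `dE ∘ φ_{w₀} = GL2CCoeff.coeffPlaceLie` (from `isDifferentiableRep_archCoeff`), and its strong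
  (vector-valued) form in the finite-dimensional `E_λ(ℂ)` (normed through a basis:
  `CoeffModule.normedAddCommGroup`);
* `coeffRepC_scalar` — the centre: `a · 1` acts by `∏_τ (τ̃(a)²)^{λ_{τ,1}} τ̃(a)^{d_τ}`.
[cite: BorelWallach2000, 0 §2.3 and VII §2.2] [cite: Harder1987, §3.1]

Definitions with bodies (`embGL`, `coeffRepC`, the norm) and theorems; no named fact.
-/

noncomputable section

-- Mathlib idiom (Mathlib/Algebra/Lie/OfAssociative.lean), as in `ArchCoeffComplexPlaceCasimir`.
attribute [local instance 100] LieRing.ofAssociativeRing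

open scoped Matrix ComplexConjugate TensorProduct MatrixGroups Topology Matrix.Norms.Operator
open Complex Filter

namespace Literature.NumberTheory.Automorphic

/-! ### A norm on the finite-dimensional coefficient module -/

namespace ResGLnCohomology.CoeffModule

variable (K : Type) [Field K] [NumberField K] (n : ℕ) (lam : (K →+* ℂ) → Fin n → ℤ)

/-- `E_λ(ℂ)` is finite-dimensional. [folklore] -/
instance instFiniteDimensional : FiniteDimensional ℂ (ResGLnCohomology.CoeffModule ℂ n K lam) :=
  ResGLnCohomology.finiteDimensional_coeffModule n K lam

/-- **A norm on `E_λ(ℂ)`** (any two are equivalent): the sup norm of the coordinates in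
`Module.finBasis` (Mathlib's `NormedAddCommGroup.induced` along the coordinate isomorphism, so that
the underlying additive group is the given one). [folklore] -/
instance normedAddCommGroup : NormedAddCommGroup (ResGLnCohomology.CoeffModule ℂ n K lam) :=
  NormedAddCommGroup.induced (ResGLnCohomology.CoeffModule ℂ n K lam)
    (Fin (Module.finrank ℂ (ResGLnCohomology.CoeffModule ℂ n K lam)) → ℂ)
    (Module.finBasis ℂ (ResGLnCohomology.CoeffModule ℂ n K lam)).equivFun.toLinearMap
    (Module.finBasis ℂ (ResGLnCohomology.CoeffModule ℂ n K lam)).equivFun.injective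

/-- The corresponding normed `ℂ`-space structure. [folklore] -/
instance normedSpace : NormedSpace ℂ (ResGLnCohomology.CoeffModule ℂ n K lam) :=
  NormedSpace.induced ℂ (ResGLnCohomology.CoeffModule ℂ n K lam)
    (Fin (Module.finrank ℂ (ResGLnCohomology.CoeffModule ℂ n K lam)) → ℂ)
    (Module.finBasis ℂ (ResGLnCohomology.CoeffModule ℂ n K lam)).equivFun.toLinearMap

end ResGLnCohomology.CoeffModule

/-! ### Weak-to-strong derivatives in a finite-dimensional space -/

/-- In a finite-dimensional normed space a curve whose every linear functional is differentiable
(with the expected derivative) is differentiable. [folklore] -/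
theorem hasDerivAt_of_dual {E : Type*} [NormedAddCommGroup E] [NormedSpace ℂ E] [FiniteDimensional ℂ E]
    {g : ℝ → E} {g' : E} {t : ℝ}
    (h : ∀ ℓ : Module.Dual ℂ E, HasDerivAt (fun s => ℓ (g s)) (ℓ g') t) : HasDerivAt g g' t := by
  let b := Module.finBasis ℂ E
  have hg : g = fun s => ∑ i, (b.coord i (g s)) • b i := funext fun s => (b.sum_repr (g s)).symm
  have hg' : g' = ∑ i, (b.coord i g') • b i := (b.sum_repr g').symm
  rw [hg, hg']
  refine HasDerivAt.fun_sum fun i _ => ?_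
  exact (h (b.coord i)).smul_const (b i)

namespace GL2CCoeff

open scoped Classical
open _root_.NumberField _root_.NumberField.InfinitePlace _root_.NumberField.mixedEmbedding
open RealMatrixGroup GLnCohomology ResGLnCohomology ComplexPlace ImaginaryQuadratic IsDedekindDomain

variable (K : Type) [Field K] [NumberField K] [IsTotallyComplex K] (lam : (K →+* ℂ) → Fin 2 → ℤ)

/-! ### `GL₂(ℂ) ↪ G_∞` -/

omit [NumberField K] in
/-- `ofComplex` is continuous. [folklore] -/
theorem continuous_ofComplex : Continuous (ofComplex K) :=
  continuous_prodMk.2 ⟨continuous_const, continuous_pi fun _ => continuous_id⟩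

/-- **`GL₂(ℂ) →* G_∞ = GL₂(K_∞)`**, entrywise `ofComplex`. [cite: BorelJacquet1979, §4.1] -/
def embGL : GL (Fin 2) ℂ →* (archGroupGL 2 K).carrier :=
  (Matrix.GeneralLinearGroup.map (ofComplex K : ℂ →+* mixedSpace K)).codRestrict
    (archGroupGL 2 K).carrier fun _ => Subgroup.mem_top _

/-- Unfolding. [folklore] -/
@[simp] theorem coe_embGL (g : GL (Fin 2) ℂ) :
    ((embGL K g : (archGroupGL 2 K).carrier) : GL (Fin 2) (mixedSpace K)) =
      Matrix.GeneralLinearGroup.map (ofComplex K : ℂ →+* mixedSpace K) g := rfl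

/-- `ofArch ∘ embGL = ofComplexGL`. [folklore] -/
theorem ofArch_embGL {hcpt : isCompact_glFiniteIntegralLevel 2 K} (g : GL (Fin 2) ℂ) :
    (AutomorphyDatum.gl 2 K hcpt).ofArch (embGL K g) = ofComplexGL K 2 g := rfl

/-- With one infinite place, `complexPlaceLie` at `w₀` is entrywise `ofComplex`. [folklore] -/
theorem complexPlaceLie_eq_map (hK : Subsingleton (InfinitePlace K)) (Y : Matrix (Fin 2) (Fin 2) ℂ) :
    complexPlaceLie 2 (complexPlace K) Y = Y.map (ofComplex K) := by
  refine Matrix.ext fun i j => ?_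
  rw [complexPlaceLie_apply, Matrix.map_apply]
  refine Prod.ext ?_ ?_
  · funext w; exact (isEmpty_isReal K).elim w
  · funext w
    rw [ofComplex_apply_snd]
    have hw : w = complexPlace K := Subsingleton.elim _ _
    subst hw
    exact Pi.single_eq_same _ _

/-- **`embGL (exp Y) = exp (φ_{w₀} Y)`** in `G_∞`. [cite: Hall2015, Prop. 2.3] -/
theorem embGL_expGL (hK : Subsingleton (InfinitePlace K)) (Y : Matrix (Fin 2) (Fin 2) ℂ) :
    embGL K (expGL Y) = (archGroupGL 2 K).expMem (placeLie 2 (complexPlace K) Y) := by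
  refine Subtype.ext (Units.ext ?_)
  change (NormedSpace.exp Y).map (ofComplex K) = NormedSpace.exp (complexPlaceLie 2 (complexPlace K) Y)
  rw [complexPlaceLie_eq_map K hK, ← RingHom.mapMatrix_apply, ← RingHom.mapMatrix_apply]
  exact NormedSpace.map_exp ((ofComplex K).mapMatrix : Matrix (Fin 2) (Fin 2) ℂ →+* _)
    (Continuous.matrix_map continuous_id (continuous_ofComplex K)) Y

/-- The same along a one-parameter subgroup. [folklore] -/
theorem embGL_expGL_smul (hK : Subsingleton (InfinitePlace K)) (Y : Matrix (Fin 2) (Fin 2) ℂ) (s : ℝ) :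
    embGL K (expGL (s • Y)) = (archGroupGL 2 K).expMem (s • placeLie 2 (complexPlace K) Y) := by
  rw [embGL_expGL K hK, map_smul]

/-- With one infinite place, `ofComplex ∘ σ₀` is the mixed embedding. [folklore] -/
theorem ofComplex_placeEmbedding (hK : Subsingleton (InfinitePlace K)) (x : K) :
    ofComplex K (placeEmbedding K x) = mixedEmbedding K x := by
  refine Prod.ext ?_ ?_
  · funext w; exact (isEmpty_isReal K).elim w
  · funext w
    rw [ofComplex_apply_snd, mixedEmbedding_apply_isComplex]
    have hw : w = complexPlace K := Subsingleton.elim _ _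
    subst hw
    rfl

/-- **Rational points: `embGL (σ₀ γ) = diagArch γ`.** [folklore] -/
theorem embGL_ratToComplexGL (hK : Subsingleton (InfinitePlace K)) (γ : GL (Fin 2) K) :
    embGL K (ratToComplexGL K 2 γ) = ParallelWeight.diagArch K 2 γ := by
  refine Subtype.ext (Matrix.GeneralLinearGroup.ext fun i j => ?_)
  change ofComplex K (placeEmbedding K (γ i j)) = mixedEmbedding K (γ i j)
  exact ofComplex_placeEmbedding K hK _

/-! ### The representation -/

/-- **`E_λ(ℂ)` as a representation of `GL₂(ℂ)`** (`archCoeffRep ∘ embGL`).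
[cite: BorelWallach2000, VII §2.2] -/
def coeffRepC : Representation ℂ (GL (Fin 2) ℂ) (ResGLnCohomology.CoeffModule ℂ 2 K lam) :=
  (ResGLnCohomology.archCoeffRep 2 K lam).comp (embGL K)

/-- Unfolding. [folklore] -/
theorem coeffRepC_apply (g : GL (Fin 2) ℂ) :
    coeffRepC K lam g = ResGLnCohomology.archCoeffRep 2 K lam (embGL K g) := rfl

/-- **On rational points `coeffRepC (σ₀ γ) = coeffRep γ`** — the algebraic representation defining
the local system `Ẽ_λ`. [cite: GrobnerRaghuram2014, §7.1] -/
theorem coeffRepC_ratToComplexGL (hK : Subsingleton (InfinitePlace K)) (γ : GL (Fin 2) K) :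
    coeffRepC K lam (ratToComplexGL K 2 γ) = coeffRep ℂ 2 K lam γ := by
  rw [coeffRepC_apply, embGL_ratToComplexGL K hK, ResGLnCohomology.archCoeffRep_diagArch]

/-- The same on `GL₂(K)⁺ = GL₂(K)`. [folklore] -/
theorem coeffRepC_ratToComplexGL_pos (hK : Subsingleton (InfinitePlace K)) (γ : glTotPos 2 K) :
    coeffRepC K lam (ratToComplexGL K 2 (γ : GL (Fin 2) K)) = coeffRepPos ℂ 2 K lam γ := by
  rw [coeffRepC_ratToComplexGL K lam hK, coeffRepPos_apply]

/-! ### The derivative along one-parameter subgroups -/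

/-- **Weak derivative**: `d/ds|₀ ℓ(E(exp sY) v) = ℓ(dE(φ_{w₀} Y) v)`. [cite: BorelWallach2000, 0 §2.3] -/
theorem hasDerivAt_coeffRepC_expGL_dual (hK : Subsingleton (InfinitePlace K)) (Y : Matrix (Fin 2) (Fin 2) ℂ)
    (v : ResGLnCohomology.CoeffModule ℂ 2 K lam) (ℓ : Module.Dual ℂ (ResGLnCohomology.CoeffModule ℂ 2 K lam)) :
    HasDerivAt (fun s : ℝ => ℓ (coeffRepC K lam (expGL (s • Y)) v))
      (ℓ (coeffPlaceLie K lam (complexPlace K) Y v)) 0 := by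
  have h := (ResGLnCohomology.isDifferentiableRep_archCoeff 2 K lam).hasDerivAt_coeff
    (placeLie 2 (complexPlace K) Y) v ℓ
  refine h.congr_of_eventuallyEq (Eventually.of_forall fun s => ?_)
  simp only [coeffRepC_apply, embGL_expGL_smul K hK]

/-- **Strong derivative**: `d/ds|₀ E(exp sY) v = dE(φ_{w₀} Y) v` in `E_λ(ℂ)`. [cite: BorelWallach2000, 0 §2.3] -/
theorem hasDerivAt_coeffRepC_expGL (hK : Subsingleton (InfinitePlace K)) (Y : Matrix (Fin 2) (Fin 2) ℂ)
    (v : ResGLnCohomology.CoeffModule ℂ 2 K lam) :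
    HasDerivAt (fun s : ℝ => coeffRepC K lam (expGL (s • Y)) v) (coeffPlaceLie K lam (complexPlace K) Y v) 0 :=
  hasDerivAt_of_dual fun ℓ => hasDerivAt_coeffRepC_expGL_dual K lam hK Y v ℓ

/-- **At a general point**: `d/ds|₀ E(M exp sY) v = E(M) dE(φ_{w₀} Y) v`. [cite: BorelWallach2000, 0 §2.3] -/
theorem hasDerivAt_coeffRepC_mul_expGL (hK : Subsingleton (InfinitePlace K)) (M : GL (Fin 2) ℂ)
    (Y : Matrix (Fin 2) (Fin 2) ℂ) (v : ResGLnCohomology.CoeffModule ℂ 2 K lam) :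
    HasDerivAt (fun s : ℝ => coeffRepC K lam (M * expGL (s • Y)) v)
      (coeffRepC K lam M (coeffPlaceLie K lam (complexPlace K) Y v)) 0 := by
  have h := hasDerivAt_coeffRepC_expGL K lam hK Y v
  have hlin : HasDerivAt (fun s : ℝ => ((coeffRepC K lam M).restrictScalars ℝ).toContinuousLinearMap
      (coeffRepC K lam (expGL (s • Y)) v))
      (((coeffRepC K lam M).restrictScalars ℝ).toContinuousLinearMap (coeffPlaceLie K lam (complexPlace K) Y v)) 0 :=
    ((coeffRepC K lam M).restrictScalars ℝ).toContinuousLinearMap.hasFDerivAt.comp_hasDerivAt 0 h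
  refine hlin.congr_of_eventuallyEq (Eventually.of_forall fun s => ?_)
  simp only [map_mul, Module.End.mul_apply, LinearMap.coe_toContinuousLinearMap', LinearMap.coe_restrictScalars]

/-! ### The centre -/

/-- `a · 1` acts on `(kⁿ)^{⊗d}` by `a^d` (as in `ParallelWeightCentralCharacter`). [cite: FultonHarrisGTM129, §15.5] -/
theorem glTensorRep_scalar' {k : Type*} [Field k] {n d : ℕ} (a : kˣ) (x : TensorPower k d (Fin n → k)) :
    Literature.NumberTheory.DiophantineGeometry.glTensorRep (Fin n) k d (Matrix.GeneralLinearGroup.scalar (Fin n) a) x =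
      ((a : k) ^ d) • x := by
  induction x using PiTensorProduct.induction_on with
  | smul_tprod r v =>
    rw [map_smul, Literature.NumberTheory.DiophantineGeometry.glTensorRep_tprod, Matrix.GeneralLinearGroup.coe_scalar]
    have : (fun i => (Matrix.scalar (Fin n) (a : k)).mulVec (v i)) = fun i => (a : k) • v i := by
      funext i; ext x; simp [Matrix.scalar_apply, Matrix.mulVec_diagonal]
    rw [this, MultilinearMap.map_smul_univ, Finset.prod_const, Finset.card_univ, Fintype.card_fin, smul_comm]
  | add x y hx hy => rw [map_add, hx, hy, smul_add]

/-- `a · 1` acts on `V_λ` by `(aⁿ)^{λ_{n−1}} a^{d}` (as in `ParallelWeightCentralCharacter`).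
[cite: FultonHarrisGTM129, §15.5] -/
theorem coeffRepGL_scalar' {k : Type} [Field k] {n : ℕ} (wt : Fin n → ℤ) (a : kˣ) (w : GLnCohomology.CoeffModule k n wt) :
    coeffRepGL k n wt (Matrix.GeneralLinearGroup.scalar (Fin n) a) w =
      ((((a ^ n) ^ lowestEntry wt : kˣ) : k) * (a : k) ^ coeffDegree wt) • w := by
  have h1 : weylRepCoeff k n wt (Matrix.GeneralLinearGroup.scalar (Fin n) a) w = ((a : k) ^ coeffDegree wt) • w := by
    change (Literature.NumberTheory.DiophantineGeometry.weylRep k (Fin n) (coeffPartition wt)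
        (Matrix.GeneralLinearGroup.scalar (Fin n) a) w :
        Literature.NumberTheory.DiophantineGeometry.weylModule k (Fin n) (coeffPartition wt)) =
      (((a : k) ^ coeffDegree wt) • w : Literature.NumberTheory.DiophantineGeometry.weylModule k (Fin n) (coeffPartition wt))
    refine Subtype.ext ?_
    rw [Literature.NumberTheory.DiophantineGeometry.coe_weylRep_apply, glTensorRep_scalar']
    rfl
  rw [coeffRepGL_apply, h1, smul_smul, Matrix.GeneralLinearGroup.det_scalar, Fintype.card_fin]


/-- `τ̃ (ofComplex z)` is `z` at `σ₀` and `z̄` at `σ̄₀`. [folklore] -/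
theorem embeddingExt_ofComplex (hK : Subsingleton (InfinitePlace K)) (τ : K →+* ℂ) (z : ℂ) :
    embeddingExt τ (ofComplex K z) = if τ = placeEmbedding K then z else conj z := by
  have hw : InfinitePlace.mk τ = (complexPlace K).1 := Subsingleton.elim _ _
  have hnr : ¬ (InfinitePlace.mk τ).IsReal := by
    rw [hw]; exact not_isReal_iff_isComplex.2 (complexPlace K).2
  by_cases h : τ = placeEmbedding K
  · rw [if_pos h]
    have h' : (InfinitePlace.mk τ).embedding = τ := by rw [hw, h]; rfl
    rw [embeddingExt_of_eq hnr h', evalComplexAlgHom_apply, ofComplex_apply_snd]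
  · rw [if_neg h]
    have h' : (InfinitePlace.mk τ).embedding ≠ τ := by rw [hw]; exact fun e => h e.symm
    rw [embeddingExt_of_ne hnr h', AlgHom.comp_apply, evalComplexAlgHom_apply,
      ofComplex_apply_snd]
    rfl

/-- **The centre**: `a · 1 ∈ GL₂(ℂ)` acts on `E_λ(ℂ)` by the scalar
`∏_τ (a_τ²)^{λ_{τ,1}} a_τ^{d_τ}`, `a_τ = τ̃(a)` (`= a` at `σ₀`, `ā` at `σ̄₀`). [cite: FultonHarrisGTM129, §15.5] -/
theorem coeffRepC_scalar (a : ℂˣ) :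
    coeffRepC K lam (Matrix.GeneralLinearGroup.scalar (Fin 2) a) =
      (∏ τ : K →+* ℂ, ((embeddingExt τ (ofComplex K a) ^ 2) ^ lowestEntry (lam τ) *
        embeddingExt τ (ofComplex K a) ^ coeffDegree (lam τ))) • LinearMap.id := by
  refine ResGLnCohomology.CoeffModule.hom_ext fun w => ?_
  rw [coeffRepC_apply, ResGLnCohomology.archCoeffRep_apply_tprod, LinearMap.smul_apply, LinearMap.id_apply]
  have key : ∀ τ : K →+* ℂ, ParallelWeight.factorRep K 2 (lam τ) τ (embGL K (Matrix.GeneralLinearGroup.scalar (Fin 2) a)) (w τ) =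
      ((embeddingExt τ (ofComplex K a) ^ 2) ^ lowestEntry (lam τ) * embeddingExt τ (ofComplex K a) ^ coeffDegree (lam τ)) • w τ := by
    intro τ
    have hu : IsUnit (embeddingExt τ (ofComplex K a)) := (a.isUnit.map (ofComplex K)).map (embeddingExt τ)
    rw [ParallelWeight.factorRep_apply]
    have hg : Matrix.GeneralLinearGroup.map (embeddingExt τ : mixedSpace K →+* ℂ)
        ((embGL K (Matrix.GeneralLinearGroup.scalar (Fin 2) a) : (archGroupGL 2 K).carrier) :
          GL (Fin 2) (mixedSpace K)) = Matrix.GeneralLinearGroup.scalar (Fin 2) hu.unit := by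
      refine Matrix.GeneralLinearGroup.ext fun i j => ?_
      rw [Matrix.GeneralLinearGroup.map_apply, coe_embGL, Matrix.GeneralLinearGroup.map_apply,
        Matrix.GeneralLinearGroup.coe_scalar, Matrix.GeneralLinearGroup.coe_scalar, IsUnit.unit_spec]
      by_cases hij : i = j
      · subst hij; simp
      · simp [hij]
    rw [hg, coeffRepGL_scalar', Units.val_zpow_eq_zpow_val, Units.val_pow_eq_pow_val, IsUnit.unit_spec]
  simp_rw [key]
  change PiTensorProduct.tprod ℂ (fun τ => _ • w τ) = _
  rw [MultilinearMap.map_smul_univ]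
  rfl

end GL2CCoeff

/-! ### Completeness of the normed coefficient module (appended) -/

namespace ResGLnCohomology.CoeffModule

/-- `E_λ(ℂ)` is complete for the norm above (it is finite-dimensional), so that Bochner integrals of
`E_λ(ℂ)`-valued functions — periods of `E_λ`-valued differential forms — are available. [folklore] -/
instance completeSpace (K : Type) [Field K] [NumberField K] (n : ℕ) (lam : (K →+* ℂ) → Fin n → ℤ) :
    CompleteSpace (ResGLnCohomology.CoeffModule ℂ n K lam) :=
  FiniteDimensional.complete ℂ _

/-- Every `ℂ`-linear endomorphism of `E_λ(ℂ)` is continuous (finite-dimensional domain); in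
particular the coefficient action of the arithmetic group. [folklore] -/
theorem continuous_linearMap (K : Type) [Field K] [NumberField K] (n : ℕ)
    (lam : (K →+* ℂ) → Fin n → ℤ)
    (f : ResGLnCohomology.CoeffModule ℂ n K lam →ₗ[ℂ] ResGLnCohomology.CoeffModule ℂ n K lam) :
    Continuous f :=
  LinearMap.continuous_of_finiteDimensional f

end ResGLnCohomology.CoeffModule

end Literature.NumberTheory.Automorphic

end
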